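import Summits.CriticalPhenomena.PercolationContinuityZ3.Theorems.Transplant.Slab111VSoundR
import Summits.CriticalPhenomena.PercolationContinuityZ3.Theorems.Transplant.VDiamond
import HarnessLib
/-!
# The routing certificate for `ShapedLinkage 3 (Slab111.hexShadow k)`, V: soundness of the checker — semantic predicates and the terminal package

builds on p205010 (kernel theorem, internal audit signed; external expert review pending) — NOT used in this file.  Lane `prim-bschramm`, seat
`prim-bschramm-p2` (gen 35; class C1b; memo `HOME/bschramm/P2-LATTICES.md` §129); helper file (`--supports stmt-CriticalPhenomena-4575 --as helper`).
Third part of the soundness of `PlanD.check` («Slab111VPlan»): the semantic predicates under which a checked plan is assembled («Slab111VSwap») —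
`Serves` (a terminal option serves a terminal at reference level `ℓ`), `InReg` (a vertex lies in an option's region), `LevelOK` (the level facts of a
placement) — and the TERMINAL PACKAGE `term_pkg`: the film path from the port to the terminal (exact: trivial; ride: «Slab111VSoundR»), inside the
option's region and the cleared set.
* §1 `EnvOK`, `Serves`, `InReg`, `LevelOK`; disjointness from regions (`ne_of_inReg`, `ne_of_inReg_inReg`, `clash_comm`);
* §2 the terminal package (`env_mem_of_between`, `term_pkg`);
* §3 list helpers for the assembly.
[cite: DuminilCopinSidoraviciusTassion2016, §2.3 (proof of Fact 2: γ_u, γ_v, γ_w)]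
-/

noncomputable section

namespace Summit.CriticalPhenomena.PercolationContinuityZ3.Theorems.Transplant

open Literature.Probability.Percolation Literature.Probability.LatticeModels SimpleGraph
open scoped Classical

namespace Slab111

variable {k : ℕ}


/-! ## §1 Semantic predicates -/

/-- Envelope condition on the terminal's level: a `ge`/`le` envelope must contain the terminal's level and its face level. [folklore] -/
def EnvOK (ℓ : ℤ) (a : AttD) (e : Env) (h : ℤ) : Prop :=
  match e with
  | Env.any => True
  | Env.ge fl => fl ≤ h - ℓ + min a.ext 0
  | Env.le ce => h - ℓ + max a.ext 0 ≤ ce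

/-- **The terminal option serves the terminal `X`**: exact — `X` is that vertex; ride — `X` lies over the terminal column, its status is served,
and the envelope condition holds. [folklore] -/
def Serves (k : ℕ) (z : Site 2) (ℓ : ℤ) (C : Ctx) (t : TermD) (X : slab111 k) : Prop :=
  match t with
  | TermD.exact v => X = absV k z ℓ v
  | TermD.ride a e => sh X = vcol z a.c ∧ rideStatusOK C a (statusOf k (lev (X : Site 3))) = true ∧ EnvOK ℓ a e (lev (X : Site 3))

/-- The film vertex lies in the ride region of the terminal option. [folklore] -/
def InReg (z : Site 2) (ℓ : ℤ) (t : TermD) (v : slab111 k) : Prop :=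
  match t with
  | TermD.exact _ => False
  | TermD.ride a e => ∃ q ∈ a.foot, sh v = vcol z q ∧ e.mem (lev (v : Site 3) - ℓ) = true

/-- **Level facts of a placement** (what the per-kind level lemmas provide): every rigid vertex is in range with its boundary codes clean, and the
ride ports at level `0` / `k` have a clean face column next to them. [folklore] -/
def LevelOK (k : ℕ) (C : Ctx) (ℓ : ℤ) (P : PlanD) : Prop :=
  (∀ w ∈ P.rigid, 0 ≤ ℓ + w.2 ∧ ℓ + w.2 ≤ k ∧ (ℓ + w.2 = 0 → codeFree C 0 w.1 = true) ∧ (ℓ + w.2 = 1 → codeFree C 1 w.1 = true) ∧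
      (ℓ + w.2 = (k : ℤ) - 1 → codeFree C 2 w.1 = true) ∧ (ℓ + w.2 = k → codeFree C 3 w.1 = true)) ∧
  (∀ tp ∈ P.ridePorts, match tp with
    | (TermD.ride a _, p) => (ℓ + p.2 = 0 → codeFree C 1 (a.colBot C.c0 1) = true) ∧ (ℓ + p.2 = k → codeFree C 2 (a.colTop C.c0 C.kr 1) = true)
    | _ => True)

/-- A vertex in a ride region differs from every unblocked rigid vertex. [folklore] -/
theorem ne_of_inReg {z : Site 2} {ℓ : ℤ} {t : TermD} {v : slab111 k} (hv : InReg z ℓ t v) {w : MV} (hw : MAdm k (shiftMV z ℓ w))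
    (hnb : t.blocks w = false) : absV k z ℓ w ≠ v := by
  cases t with
  | exact _ => exact hv.elim
  | ride a e =>
    obtain ⟨q, hq, hs, he⟩ := hv
    exact ne_of_not_blocks hq hs he hw hnb

/-- Vertices in the regions of two non-clashing ride options differ. [folklore] -/
theorem ne_of_inReg_inReg {z : Site 2} {ℓ : ℤ} {t t' : TermD} {v v' : slab111 k} (hv : InReg z ℓ t v) (hv' : InReg z ℓ t' v')
    (hcl : t.clash t' = false) : v ≠ v' := by
  cases t with
  | exact _ => exact hv.elim
  | ride a e =>
    cases t' with
    | exact _ => exact hv'.elim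
    | ride a' e' =>
      obtain ⟨q, hq, hs, -⟩ := hv
      obtain ⟨q', hq', hs', -⟩ := hv'
      have hcl' : (TermD.ride a Env.any).clash (TermD.ride a' Env.any) = false := by simpa [TermD.clash] using hcl
      exact ne_of_foot_disjoint hcl' hq hq' hs hs'

/-- `clash` is symmetric (in the form needed). [folklore] -/
theorem clash_comm {t t' : TermD} (h : t.clash t' = false) : t'.clash t = false := by
  cases t with
  | exact _ => cases t' <;> rfl
  | ride a e =>
    cases t' with
    | exact _ => rfl
    | ride a' e' =>
      simp only [TermD.clash] at h ⊢
      rw [Bool.eq_false_iff] at h ⊢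
      intro h'
      apply h
      simp only [List.any_eq_true, List.contains_iff_mem] at h' ⊢
      obtain ⟨q, hq, hq'⟩ := h'
      exact ⟨q, hq', hq⟩

/-! ## §2 The terminal package -/

/-- Envelope membership of a level between the port and the terminal, from the port's envelope membership and `EnvOK`. [folklore] -/
theorem env_mem_of_between {ℓ : ℤ} {a : AttD} {e : Env} {p2 h L : ℤ} (hp : e.mem p2 = true) (henv : EnvOK ℓ a e h)
    (hL : (min (ℓ + p2) (h + a.ext) ≤ L ∧ L ≤ max (ℓ + p2) (h + a.ext)) ∨ L = h) : e.mem (L - ℓ) = true := by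
  cases e with
  | any => rfl
  | ge fl =>
    simp only [Env.mem, decide_eq_true_eq, EnvOK] at hp henv ⊢
    have h1 : min a.ext 0 ≤ a.ext := min_le_left _ _; have h2 : min a.ext 0 ≤ 0 := min_le_right _ _
    rcases hL with ⟨hL1, -⟩ | rfl
    · rcases le_total (ℓ + p2) (h + a.ext) with hc | hc
      · rw [min_eq_left hc] at hL1; omega
      · rw [min_eq_right hc] at hL1; omega
    · omega
  | le ce =>
    simp only [Env.mem, decide_eq_true_eq, EnvOK] at hp henv ⊢
    have h1 : a.ext ≤ max a.ext 0 := le_max_left _ _; have h2 : 0 ≤ max a.ext 0 := le_max_right _ _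
    rcases hL with ⟨-, hL2⟩ | rfl
    · rcases le_total (ℓ + p2) (h + a.ext) with hc | hc
      · rw [max_eq_right hc] at hL2; omega
      · rw [max_eq_left hc] at hL2; omega
    · omega

/-- **The terminal package**: a path from the port's vertex to the terminal whose other vertices lie in the option's region, all cleared
(over the rerouting block when `roleE`). [folklore] -/
theorem term_pkg {z : Site 2} {ℓ : ℤ} {K : BKey} (hℓ : ℓ % 3 = (cls z : ℤ)) (hk5 : 5 ≤ k) {t : TermD} {roleE : Bool}
    (ht : t.ok (Ctx.of K (cls z) (k % 3)) roleE = true) {p : MV} (hport : t.isPort p = true) (hpv : vOK p = true) (hp0 : 0 ≤ ℓ + p.2)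
    (hpk : ℓ + p.2 ≤ k) (hpW : absV k z ℓ p ∈ Wset k z K.tR K.tD K.sR K.sD)
    (hpR : roleE = true → absV k z ℓ p ∈ Wset k z K.tR K.tD K.sR K.sD ∩ (hexShadow k).lift (blkR 3 z K.tR K.sR))
    (hport0 : ∀ a e, t = TermD.ride a e → ℓ + p.2 = 0 → codeFree (Ctx.of K (cls z) (k % 3)) 1 (a.colBot (cls z) 1) = true)
    (hportk : ∀ a e, t = TermD.ride a e → ℓ + p.2 = k → codeFree (Ctx.of K (cls z) (k % 3)) 2 (a.colTop (cls z) (k % 3) 1) = true)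
    {X : slab111 k} (hX : Serves k z ℓ (Ctx.of K (cls z) (k % 3)) t X) (hXW : X ∈ Wset k z K.tR K.tD K.sR K.sD)
    (hXR : roleE = true → X ∈ Wset k z K.tR K.tD K.sR K.sD ∩ (hexShadow k).lift (blkR 3 z K.tR K.sR)) :
    ∃ R : List (slab111 k), GPath (film k) R (absV k z ℓ p) X ∧ (∀ v ∈ R, v = absV k z ℓ p ∨ InReg z ℓ t v) ∧
      (∀ v ∈ R, v ∈ Wset k z K.tR K.tD K.sR K.sD) ∧ (roleE = true → ∀ v ∈ R, v ∈ Wset k z K.tR K.tD K.sR K.sD ∩ (hexShadow k).lift (blkR 3 z K.tR K.sR)) := by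
  cases t with
  | exact v =>
    simp only [TermD.isPort, beq_iff_eq] at hport
    subst hport
    simp only [Serves] at hX
    subst hX
    exact ⟨[absV k z ℓ p], GPath.single _ _, fun v hv => Or.inl (by simpa using hv), fun v hv => by simp at hv; exact hv ▸ hpW,
      fun hr v hv => by simp at hv; exact hv ▸ hpR hr⟩
  | ride a e =>
    simp only [TermD.isPort, Bool.and_eq_true] at hport
    obtain ⟨hpF, hpe⟩ := hport
    have hpF' : p.1 ∈ a.fcols := by simpa using hpF
    obtain ⟨hXc, hstat, henv⟩ := hX
    simp only [TermD.ok] at ht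
    obtain ⟨R, hR, hRsh, hRlev, hRW, hRR⟩ := ride_exists hℓ hk5 ht hpv hpF' hp0 hpk hpW (hport0 a e rfl) (hportk a e rfl) hXc hXW hXR hstat
    refine ⟨R, hR, fun v hv => ?_, hRW, hRR⟩
    right
    obtain ⟨q, hq, hs⟩ := hRsh v hv
    exact ⟨q, hq, hs, env_mem_of_between hpe henv ((hRlev v hv).imp_right fun e => by rw [e])⟩

/-! ## §3 List helpers -/

/-- `contains = false` means not a member. [folklore] -/
theorem notin_of_contains_false {l : List MV} {w : MV} (h : l.contains w = false) : w ∉ l := by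
  intro hw; have := List.contains_iff_mem.2 hw; rw [h] at this; exact Bool.false_ne_true this

/-- `(w == v) = false` means `w ≠ v`. [folklore] -/
theorem ne_of_beq_false' {w v : MV} (h : (w == v) = false) : w ≠ v := by
  intro e; subst e; simp at h


/-- Elements of a list other than its head lie in its tail. [folklore] -/
theorem mem_tail_of_ne_head {α : Type} {l : List α} {x h : α} (hx : x ∈ l) (hh : l.head? = some h) (hne : x ≠ h) : x ∈ l.tail := by
  cases l with
  | nil => simp at hx
  | cons y ys => simp at hh; subst hh; simpa [hne] using hx

/-- Elements of a list other than its last lie in `dropLast`. [folklore] -/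
theorem mem_dropLast_of_ne_getLast {α : Type} {l : List α} {x g : α} (hx : x ∈ l) (hg : l.getLast? = some g) (hne : x ≠ g) : x ∈ l.dropLast := by
  have hne' : l ≠ [] := by rintro rfl; simp at hx
  have hgl : l.getLast hne' = g := by rw [List.getLast?_eq_some_getLast hne'] at hg; simpa using hg
  have := List.dropLast_append_getLast hne'
  rw [hgl] at this
  rw [← this] at hx
  rcases List.mem_append.1 hx with h | h
  · exact h
  · simp at h; exact absurd h hne

end Slab111

end Summit.CriticalPhenomena.PercolationContinuityZ3.Theorems.Transplant
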